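import Summits.FinalStateConjecture.FinalStateConjecture.Theorems.ClusterCompletenessAdiabaticMultiKerrILEDField
import HarnessLib

/-!
# Route ClusterCompleteness — crux `AdiabaticMultiKerrILED`, line `Sketch`: the rest-frame
# pull-back of a lab solution solves the tails-cut Kerr–Schild wave equation (one boosted zone)

Helper file for the crux `stmt-FinalStateConjecture-14310`
(`Summit.FinalStateConjecture.FinalStateConjecture.Theses.ClusterCompleteness.AdiabaticMultiKerrILED`),
line `Sketch`, stub `tailsCut_pullbackWave_single` (lead c7, wave 2): the Poincaré-covariance step
of the lab ↔ rest-frame transport for ONE boosted tails-cut zone.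

Setting: one hole of mass `M > 0` and spin `a`, boosted by `Λ ∈ O(1,3)` and centred at `p`, with
rest-frame chart `q = poincareInv Λ (0, p)` (so `q ∘ P = id` for `P w = Λ w + (0, p)`). The lab
coefficient field is the boosted TAILS-CUT Kerr–Schild field
`G(x)^{μν} = η(∂_μ, ∂_ν) − χ(q x) · 2H(q x) · (Λℓ♯(q x))^μ (Λℓ♯(q x))^ν`,
`χ = Real.smoothTransition (2 − r/(8M))`. If `ψ ∈ C^∞` solves the divergence-form equation
`Σ_μ ∂_μ (Σ_ν G^{μν} ∂_ν ψ) = 0` at the lab points `x` with `x⁰ ≥ 0` and `r₊ < r(q x)`, then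
`Φ = ψ ∘ P` solves `KerrSchild.waveOperator G_rest Φ z = 0` at every rest-frame point `z` with
`(P z)⁰ ≥ 0` and `r₊ < r(z)`, where `G_rest = KerrSchild.inverseMetric (χ · 2H) ℓ♯` is the un-boosted
tails-cut field.

Proof (the single-zone, uncut-radius version of the landed `stub_zonePullbackWave`, whose private
lemmas are copied here):
* at `x = P z` one has `q x = z`, so `x` is an admissible lab point and `□_G ψ (x) = 0`
  (`KerrSchild.waveOperator_apply` is the crux's raw double sum);
* covariance of the divergence-form operator under the affine map `P` (`waveOperator_comp_affine`:
  with `B = Λ⁻¹` and `K'(w)^{μν} = Σ_{αβ} B^μ_α B^ν_β K(Pw)^{αβ}`, `□_{K'}(u ∘ P)(z) = □_K u (Pz)`;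
  chain rule twice, the second time termwise, which needs the fluxes `Σ_β G^{αβ} ∂_β ψ` to be
  differentiable at the exterior point `x` — `r(z) > r₊ ≥ M > 0`, `contDiffAt_cruxTerm`);
* the pulled-back coefficients ARE the rest-frame tails-cut field (`pullback_boostedKerrSchild`):
  `Σ B B η = η` for `Λ ∈ O(1,3)` (`Λ⁻¹ = η Λᵀ η`), `Σ_α B^μ_α (Λℓ♯)^α = ℓ♯^μ`, and the scalar
  profile `χ(q(Pw)) · 2H(q(Pw)) = χ(w) · 2H(w)` pulls back verbatim.
O'Neill 1983, Ch. 9, pp. 233–236 (Lorentz and Poincaré maps); Kerr–Schild 1965, §2 (Lorentz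
covariance of the Kerr–Schild ansatz). [folklore]
-/

noncomputable section

-- the doubled `FinalStateConjecture.FinalStateConjecture` path component trips dupNamespace
set_option linter.dupNamespace false

open scoped ContDiff Topology BigOperators
open Filter Set Literature.Geometry.Lorentzian

namespace Summit.FinalStateConjecture.FinalStateConjecture.Theorems

/-! ### Coordinate algebra on `E4` (adapted from `…ZonePullbackWave`, private there) -/

-- adapted from ClusterCompletenessAdiabaticMultiKerrILEDZonePullbackWave (private lemmas)

/-- Expansion of a linear functional in the coordinate frame: `Σ_ν v^ν L(∂_ν) = L(v)`
(`v = Σ_ν v^ν ∂_ν`). [folklore] -/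
private theorem sum_mul_map_basisVector (L : E4 →L[ℝ] ℝ) (v : E4) :
    ∑ ν, v ν * L (E4.basisVector ν) = L v := by
  conv_rhs => rw [Kerr.eq_sum_basisVector v, map_sum]
  exact Finset.sum_congr rfl fun ν _ ↦ by rw [map_smul, smul_eq_mul]

/-- `Λ⁻¹ ∘ Λ = id` in coordinates: `Σ_α (Λ⁻¹ ∂_α)^μ (Λ v)^α = v^μ`. [folklore] -/
private theorem sum_symm_basisVector_mul (A : E4 ≃L[ℝ] E4) (v : E4) (μ : Fin 4) :
    ∑ α, (A.symm (E4.basisVector α)) μ * (A v) α = v μ := by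
  have h := sum_mul_map_basisVector
    ((EuclideanSpace.proj (𝕜 := ℝ) μ).comp (A.symm : E4 →L[ℝ] E4)) (A v)
  simp only [ContinuousLinearMap.comp_apply, ContinuousLinearEquiv.coe_coe,
    ContinuousLinearEquiv.symm_apply_apply, PiLp.proj_apply] at h
  rw [← h]
  exact Finset.sum_congr rfl fun α _ ↦ mul_comm _ _

/-- `η_{αα}² = 1`. [folklore] -/
private theorem etaComp_diag_mul_self (α : Fin 4) : Kerr.etaComp α α * Kerr.etaComp α α = 1 := by
  rw [Kerr.etaComp, if_pos rfl]
  split_ifs <;> norm_num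

/-- `η(∂_α, y) = η_{αα} y^α` (O'Neill 1983, Ch. 3, p. 55). [folklore] -/
private theorem minkowski_basisVector_left (α : Fin 4) (y : E4) :
    Minkowski.bilin (E4.basisVector α) y = Kerr.etaComp α α * y α := by
  fin_cases α <;> simp [Kerr.etaComp, E4.basisVector, Fin.sum_univ_three, Minkowski.bilin_apply]

/-- `η(y, ∂_ν) = η_{νν} y^ν` (O'Neill 1983, Ch. 3, p. 55). [folklore] -/
private theorem minkowski_basisVector_right (y : E4) (ν : Fin 4) :
    Minkowski.bilin y (E4.basisVector ν) = Kerr.etaComp ν ν * y ν := by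
  rw [Minkowski.bilin_symm, minkowski_basisVector_left]

/-- **`Λ⁻¹ = η Λᵀ η` for `Λ ∈ O(1,3)`**, in coordinates: `(Λ⁻¹ ∂_α)^ν = η_{νν} η_{αα} (Λ ∂_ν)^α`
(pair `η(Λ Λ⁻¹ ∂_α, Λ ∂_ν) = η(Λ⁻¹ ∂_α, ∂_ν)`; O'Neill 1983, Ch. 9, p. 233). [folklore] -/
private theorem lorentz_symm_basisVector_apply (Λ : lorentzGroup) (α ν : Fin 4) :
    ((Λ : E4 ≃L[ℝ] E4).symm (E4.basisVector α)) ν =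
      Kerr.etaComp ν ν * Kerr.etaComp α α * ((Λ : E4 ≃L[ℝ] E4) (E4.basisVector ν)) α := by
  have h := Λ.2 ((Λ : E4 ≃L[ℝ] E4).symm (E4.basisVector α)) (E4.basisVector ν)
  rw [ContinuousLinearEquiv.apply_symm_apply, minkowski_basisVector_left,
    minkowski_basisVector_right] at h
  have hν := etaComp_diag_mul_self ν
  calc ((Λ : E4 ≃L[ℝ] E4).symm (E4.basisVector α)) ν
      = Kerr.etaComp ν ν *
          (Kerr.etaComp ν ν * ((Λ : E4 ≃L[ℝ] E4).symm (E4.basisVector α)) ν) := by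
        rw [← mul_assoc, hν, one_mul]
    _ = _ := by rw [← h]; ring

/-- **`Λ⁻¹ η⁻¹ Λ⁻ᵀ = η⁻¹` for `Λ ∈ O(1,3)`**: `Σ_{αβ} (Λ⁻¹∂_α)^μ (Λ⁻¹∂_β)^ν η(∂_α, ∂_β) = η^{μν}`
(O'Neill 1983, Ch. 9, p. 233). [folklore] -/
private theorem sum_sum_lorentz_symm_eta (Λ : lorentzGroup) (μ ν : Fin 4) :
    ∑ α, ∑ β, ((Λ : E4 ≃L[ℝ] E4).symm (E4.basisVector α)) μ *
      ((Λ : E4 ≃L[ℝ] E4).symm (E4.basisVector β)) ν *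
      Minkowski.bilin (E4.basisVector α) (E4.basisVector β) = Kerr.etaComp μ ν := by
  have hdiag : ∀ α, ∑ β, ((Λ : E4 ≃L[ℝ] E4).symm (E4.basisVector α)) μ *
      ((Λ : E4 ≃L[ℝ] E4).symm (E4.basisVector β)) ν *
      Minkowski.bilin (E4.basisVector α) (E4.basisVector β) =
      Kerr.etaComp ν ν * (((Λ : E4 ≃L[ℝ] E4).symm (E4.basisVector α)) μ *
        ((Λ : E4 ≃L[ℝ] E4) (E4.basisVector ν)) α) := by
    intro α
    rw [Finset.sum_eq_single α (fun β _ hβα ↦ ?_) fun h ↦ absurd (Finset.mem_univ α) h]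
    · rw [Kerr.minkowski_bilin_basisVector, lorentz_symm_basisVector_apply Λ α ν]
      have hα := etaComp_diag_mul_self α
      linear_combination (Kerr.etaComp ν ν * ((Λ : E4 ≃L[ℝ] E4).symm (E4.basisVector α)) μ *
        ((Λ : E4 ≃L[ℝ] E4) (E4.basisVector ν)) α) * hα
    · rw [Kerr.minkowski_bilin_basisVector]
      simp [Kerr.etaComp, Ne.symm hβα]
  rw [Finset.sum_congr rfl fun α _ ↦ hdiag α, ← Finset.mul_sum, sum_symm_basisVector_mul]
  by_cases h : μ = ν
  · subst h
    simp [E4.basisVector]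
  · simp [E4.basisVector, Kerr.etaComp, h]

/-- **The boosted Kerr–Schild coefficients pull back to the rest-frame ones**:
`Σ_{αβ} (Λ⁻¹∂_α)^μ (Λ⁻¹∂_β)^ν (η(∂_α, ∂_β) − φ (Λl)^α (Λl)^β) = η^{μν} − φ l^μ l^ν` for
`Λ ∈ O(1,3)`, any scalar `φ` and vector `l` (Lorentz covariance of the Kerr–Schild ansatz;
Kerr–Schild 1965, §2; O'Neill 1983, Ch. 9, p. 233). [folklore] -/
theorem pullback_boostedKerrSchild (Λ : lorentzGroup) (φ : ℝ) (l : E4) (μ ν : Fin 4) :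
    ∑ α, ∑ β, ((Λ : E4 ≃L[ℝ] E4).symm (E4.basisVector α)) μ *
      ((Λ : E4 ≃L[ℝ] E4).symm (E4.basisVector β)) ν *
      (Minkowski.bilin (E4.basisVector α) (E4.basisVector β) -
        φ * ((Λ : E4 ≃L[ℝ] E4) l) α * ((Λ : E4 ≃L[ℝ] E4) l) β) =
      Kerr.etaComp μ ν - φ * l μ * l ν := by
  simp only [mul_sub, Finset.sum_sub_distrib]
  rw [sum_sum_lorentz_symm_eta]
  congr 1
  rw [← sum_symm_basisVector_mul (Λ : E4 ≃L[ℝ] E4) l μ,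
    ← sum_symm_basisVector_mul (Λ : E4 ≃L[ℝ] E4) l ν, mul_assoc, Finset.sum_mul_sum,
    Finset.mul_sum]
  refine Finset.sum_congr rfl fun α _ ↦ ?_
  rw [Finset.mul_sum]
  refine Finset.sum_congr rfl fun β _ ↦ ?_
  ring

/-! ### Covariance of the divergence-form wave operator under affine maps -/

/-- Chain rule under the affine map `P v = A v + c`: `d(f ∘ P)(w) = df(Pw) ∘ A`, without
differentiability hypothesis (both sides vanish when `f` is not differentiable at `Pw`). [folklore] -/
private theorem fderiv_comp_affine (A : E4 ≃L[ℝ] E4) (c : E4) (f : E4 → ℝ) (w : E4) :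
    fderiv ℝ (fun v ↦ f (A v + c)) w = (fderiv ℝ f (A w + c)).comp (A : E4 →L[ℝ] E4) := by
  have h : (fun v ↦ f (A v + c)) = (fun y ↦ f (y + c)) ∘ A := rfl
  rw [h, A.comp_right_fderiv, fderiv_comp_add_right]

/-- **Covariance of the divergence-form wave operator under affine reparametrisation.** For an
invertible linear `A`, a translation `c`, `P w = A w + c`, `B = A⁻¹`, a coefficient field `K` and
a function `u`, the pulled-back coefficients `K'(w)^{μν} = Σ_{αβ} (B∂_α)^μ (B∂_β)^ν K(Pw)^{αβ}`
satisfy `□_{K'} (u ∘ P) (z) = □_K u (Pz)`, provided the fluxes `V_α = Σ_β K^{αβ} ∂_β u` are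
differentiable at `Pz` (tensoriality of `∂_μ(K^{μν} ∂_ν u)` under affine maps; O'Neill 1983, Ch. 3,
p. 58 and Ch. 9, p. 236). [folklore] -/
theorem waveOperator_comp_affine (A : E4 ≃L[ℝ] E4) (c : E4)
    (K : E4 → Fin 4 → Fin 4 → ℝ) (u : E4 → ℝ) (z : E4)
    (hV : ∀ α, DifferentiableAt ℝ
      (fun y ↦ ∑ β, K y α β * fderiv ℝ u y (E4.basisVector β)) (A z + c)) :
    KerrSchild.waveOperator (fun w μ ν ↦ ∑ α, ∑ β, (A.symm (E4.basisVector α)) μ *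
        (A.symm (E4.basisVector β)) ν * K (A w + c) α β) (fun w ↦ u (A w + c)) z =
      KerrSchild.waveOperator K u (A z + c) := by
  -- the fluxes `V_α = Σ_β K^{αβ} ∂_β u`
  obtain ⟨V, hVdef⟩ : ∃ V : Fin 4 → E4 → ℝ,
      ∀ α y, V α y = ∑ β, K y α β * fderiv ℝ u y (E4.basisVector β) := ⟨_, fun _ _ ↦ rfl⟩
  have hVd : ∀ α, DifferentiableAt ℝ (V α) (A z + c) := fun α ↦ by
    rw [show V α = _ from funext (hVdef α)]
    exact hV α
  -- (1) the pulled-back fluxes: `Σ_ν K'^{μν} ∂_ν(u ∘ P) = (Σ_α (B∂_α)^μ V_α) ∘ P`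
  have h1 : ∀ μ, (fun w ↦ ∑ ν, (∑ α, ∑ β, (A.symm (E4.basisVector α)) μ *
      (A.symm (E4.basisVector β)) ν * K (A w + c) α β) *
      fderiv ℝ (fun v ↦ u (A v + c)) w (E4.basisVector ν)) =
      fun w ↦ ∑ α, (A.symm (E4.basisVector α)) μ * V α (A w + c) := by
    intro μ
    funext w
    rw [fderiv_comp_affine]
    simp only [ContinuousLinearMap.comp_apply, ContinuousLinearEquiv.coe_coe, hVdef]
    have key : ∀ β, fderiv ℝ u (A w + c) (E4.basisVector β) =
        ∑ ν, (A.symm (E4.basisVector β)) ν * fderiv ℝ u (A w + c) (A (E4.basisVector ν)) := by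
      intro β
      have h := sum_mul_map_basisVector ((fderiv ℝ u (A w + c)).comp (A : E4 →L[ℝ] E4))
        (A.symm (E4.basisVector β))
      simp only [ContinuousLinearMap.comp_apply, ContinuousLinearEquiv.coe_coe,
        ContinuousLinearEquiv.apply_symm_apply] at h
      exact h.symm
    simp only [key, Finset.mul_sum, Finset.sum_mul]
    rw [Finset.sum_comm]
    refine Finset.sum_congr rfl fun α _ ↦ ?_
    rw [Finset.sum_comm]
    refine Finset.sum_congr rfl fun β _ ↦ Finset.sum_congr rfl fun ν _ ↦ ?_
    ring
  -- (2) the outer derivative: `∂_μ ((Σ_α (B∂_α)^μ V_α) ∘ P)(z) = Σ_α (B∂_α)^μ dV_α(Pz)(A∂_μ)`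
  have h2 : ∀ μ, fderiv ℝ (fun w ↦ ∑ α, (A.symm (E4.basisVector α)) μ * V α (A w + c)) z
      (E4.basisVector μ) =
      ∑ α, (A.symm (E4.basisVector α)) μ * fderiv ℝ (V α) (A z + c) (A (E4.basisVector μ)) := by
    intro μ
    have h := fderiv_comp_affine A c (fun y ↦ ∑ α, (A.symm (E4.basisVector α)) μ * V α y) z
    beta_reduce at h
    rw [h, ContinuousLinearMap.comp_apply, ContinuousLinearEquiv.coe_coe,
      fderiv_fun_sum fun α _ ↦ (hVd α).const_mul _, _root_.sum_apply]
    refine Finset.sum_congr rfl fun α _ ↦ ?_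
    rw [fderiv_const_mul (hVd α), _root_.smul_apply, smul_eq_mul]
  -- (3) assemble: `Σ_μ (A∂_μ)^κ (B∂_α)^μ = δ^κ_α`
  rw [KerrSchild.waveOperator_apply, KerrSchild.waveOperator_apply]
  calc ∑ μ, fderiv ℝ (fun w ↦ ∑ ν, (∑ α, ∑ β, (A.symm (E4.basisVector α)) μ *
          (A.symm (E4.basisVector β)) ν * K (A w + c) α β) *
          fderiv ℝ (fun v ↦ u (A v + c)) w (E4.basisVector ν)) z (E4.basisVector μ)
      = ∑ μ, ∑ α, (A.symm (E4.basisVector α)) μ *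
          fderiv ℝ (V α) (A z + c) (A (E4.basisVector μ)) := by
        refine Finset.sum_congr rfl fun μ _ ↦ ?_
        rw [h1 μ, h2 μ]
    _ = ∑ α, ∑ μ, (A.symm (E4.basisVector α)) μ *
          fderiv ℝ (V α) (A z + c) (A (E4.basisVector μ)) := Finset.sum_comm
    _ = ∑ α, fderiv ℝ (V α) (A z + c) (E4.basisVector α) := by
        refine Finset.sum_congr rfl fun α _ ↦ ?_
        have h := sum_mul_map_basisVector ((fderiv ℝ (V α) (A z + c)).comp (A : E4 →L[ℝ] E4))
          (A.symm (E4.basisVector α))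
        simp only [ContinuousLinearMap.comp_apply, ContinuousLinearEquiv.coe_coe,
          ContinuousLinearEquiv.apply_symm_apply] at h
        exact h
    _ = _ := by
        refine Finset.sum_congr rfl fun α _ ↦ ?_
        rw [show V α = _ from funext (hVdef α)]

/-! ### The stub -/

/-- **The rest-frame pull-back of a lab solution solves the tails-cut Kerr–Schild wave equation
(one boosted zone).** For one hole `(M, a)`, `M > 0`, `|a| < M`, boosted by `Λ ∈ O(1,3)` and
centred at `p` (`q = poincareInv Λ (0, p)`, `P w = Λ w + (0, p)`, `q ∘ P = id`): if `ψ ∈ C^∞`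
solves `Σ_μ ∂_μ (Σ_ν G^{μν} ∂_ν ψ) = 0` at the lab points `x⁰ ≥ 0`, `r₊ < r(q x)` for the boosted
tails-cut field `G = η(∂_μ, ∂_ν) − χ(q ·) 2H(q ·) (Λℓ♯(q ·)) ⊗ (Λℓ♯(q ·))`, then `ψ ∘ P` solves
`KerrSchild.waveOperator (KerrSchild.inverseMetric (χ · 2H) ℓ♯) (ψ ∘ P) z = 0` at every `z`
with `(P z)⁰ ≥ 0`, `r₊ < r(z)`. Proof: `q (P z) = z` makes `P z` an admissible lab point;
covariance of the divergence-form operator under `P` (`waveOperator_comp_affine`, fluxes smooth at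
the exterior point by `contDiffAt_cruxTerm`, `r > r₊ ≥ M > 0`); and `Λ⁻¹ η⁻¹ Λ⁻ᵀ = η⁻¹`,
`Λ⁻¹(Λℓ♯) = ℓ♯` (`pullback_boostedKerrSchild`) with the scalar profile `χ · 2H` pulled back
verbatim identify the coefficients. O'Neill 1983, Ch. 9, pp. 233–236; Kerr–Schild 1965, §2.
[folklore] -/
theorem tailsCut_pullbackWave_single : ∀ (M a : ℝ) (Λ : lorentzGroup) (p : E3) (q : E4 → E4)
    (G : E4 → Fin 4 → Fin 4 → ℝ) (ψ : E4 → ℝ),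
    (∀ x, q x = poincareInv Λ (E4.ofTimeSpace 0 p) x) → 0 < M → |a| < M →
    (∀ x μ ν, G x μ ν = Minkowski.bilin (E4.basisVector μ) (E4.basisVector ν) -
      Real.smoothTransition (2 - Kerr.radius a (q x) / (8 * M)) * (2 * Kerr.scalarH M a (q x)) *
        ((Λ : E4 ≃L[ℝ] E4) (Kerr.nullVector a (q x))) μ *
        ((Λ : E4 ≃L[ℝ] E4) (Kerr.nullVector a (q x))) ν) →
    ContDiff ℝ ∞ ψ →
    (∀ x : E4, 0 ≤ x 0 → Kerr.rPlus M a < Kerr.radius a (q x) →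
      ∑ μ : Fin 4, fderiv ℝ (fun y ↦ ∑ ν : Fin 4, G y μ ν * fderiv ℝ ψ y (E4.basisVector ν)) x
        (E4.basisVector μ) = 0) →
    ∀ z : E4, 0 ≤ ((Λ : E4 ≃L[ℝ] E4) z + E4.ofTimeSpace 0 p) 0 → Kerr.rPlus M a < Kerr.radius a z →
      KerrSchild.waveOperator
        (KerrSchild.inverseMetric
          (fun y ↦ Real.smoothTransition (2 - Kerr.radius a y / (8 * M)) * (2 * Kerr.scalarH M a y))
          (Kerr.nullVector a))
        (fun w ↦ ψ ((Λ : E4 ≃L[ℝ] E4) w + E4.ofTimeSpace 0 p)) z = 0 := by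
  intro M a Λ p q G ψ hq hM _ hG hψ hsol z hz0 hzr
  -- `q ∘ P = id`
  have hqP : ∀ w, q ((Λ : E4 ≃L[ℝ] E4) w + E4.ofTimeSpace 0 p) = w := fun w ↦ by
    rw [hq, poincareInv, add_sub_cancel_right, ContinuousLinearEquiv.symm_apply_apply]
  have hzpos : 0 < Kerr.radius a z := radius_pos_of_rPlus_lt hM hzr
  -- (a) the lab point `x = P z` has `q x = z`, so it is admissible and `□_G ψ (x) = 0`
  set x : E4 := (Λ : E4 ≃L[ℝ] E4) z + E4.ofTimeSpace 0 p
  have hqx : q x = z := hqP z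
  have hsolx : KerrSchild.waveOperator G ψ x = 0 := by
    rw [KerrSchild.waveOperator_apply]
    exact hsol x hz0 (by rw [hqx]; exact hzr)
  -- (b) covariance under `P`: the fluxes `Σ_β G^{αβ} ∂_β ψ` are smooth at the exterior point `x`
  have hdψ : ∀ β, ContDiff ℝ ∞ fun y ↦ fderiv ℝ ψ y (E4.basisVector β) := fun β ↦
    (contDiff_infty_iff_fderiv.1 hψ).2.clm_apply contDiff_const
  have hV : ∀ α, DifferentiableAt ℝ
      (fun y ↦ ∑ β, G y α β * fderiv ℝ ψ y (E4.basisVector β)) x := by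
    intro α
    have hxpos : 0 < Kerr.radius a (poincareInv Λ (E4.ofTimeSpace 0 p) x) := by
      rw [← hq, hqx]; exact hzpos
    refine DifferentiableAt.fun_sum fun β _ ↦ DifferentiableAt.fun_mul ?_
      ((hdψ β).differentiable (by simp) x)
    have hfun : (fun y ↦ G y α β) = fun y ↦
        Minkowski.bilin (E4.basisVector α) (E4.basisVector β) -
          Real.smoothTransition
              (2 - Kerr.radius a (poincareInv Λ (E4.ofTimeSpace 0 p) y) / (8 * M)) *
            (2 * Kerr.scalarH M a (poincareInv Λ (E4.ofTimeSpace 0 p) y)) *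
            ((Λ : E4 ≃L[ℝ] E4) (Kerr.nullVector a (poincareInv Λ (E4.ofTimeSpace 0 p) y))) α *
            ((Λ : E4 ≃L[ℝ] E4) (Kerr.nullVector a (poincareInv Λ (E4.ofTimeSpace 0 p) y))) β := by
      funext y; rw [hG, hq]
    have hGs : ContDiffAt ℝ ∞ (fun y ↦ G y α β) x := by
      rw [hfun]
      exact contDiffAt_const.sub (contDiffAt_cruxTerm M a Λ _ hxpos α β)
    exact hGs.differentiableAt (by simp)
  have hcov := waveOperator_comp_affine (Λ : E4 ≃L[ℝ] E4) (E4.ofTimeSpace 0 p) G ψ z hV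
  -- (c) the pulled-back coefficients are the rest-frame tails-cut Kerr–Schild ones
  have hK : (fun w μ ν ↦ ∑ α, ∑ β, ((Λ : E4 ≃L[ℝ] E4).symm (E4.basisVector α)) μ *
      ((Λ : E4 ≃L[ℝ] E4).symm (E4.basisVector β)) ν *
      G ((Λ : E4 ≃L[ℝ] E4) w + E4.ofTimeSpace 0 p) α β) =
      KerrSchild.inverseMetric
        (fun y ↦ Real.smoothTransition (2 - Kerr.radius a y / (8 * M)) * (2 * Kerr.scalarH M a y))
        (Kerr.nullVector a) := by
    funext w μ ν
    simp only [hG, hqP, KerrSchild.inverseMetric]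
    exact pullback_boostedKerrSchild Λ _ _ μ ν
  rw [hK] at hcov
  rw [hcov]
  exact hsolx

end Summit.FinalStateConjecture.FinalStateConjecture.Theorems

end
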